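import Summits.QuantumFields.YangMills.Theorems.BalabanUVNodesN13DensityBelowIteratedTransportOfDeadSelAtRecord13CoPH
import Summits.QuantumFields.BalabanUV.T4Continuum.Support.ShellMeasureHistoriesTransportIterate

/-!
# BalabanUVNodes ∕ N13 — THE DENSITY OF RECORD TIMES HAAR IS THE `k`-FOLD BLOCK-AVERAGED WILSON–GIBBS MEASURE: `ρ_k·dV_k = (avg_{k−1}∘⋯∘avg_0)_*(ρ₀·dU_0)` under the tree's selector laws —
# an identity of MEASURES (version-free, no boundedness ∕ measurability row), and the iterated transport `I_k` of p616879 as a density of the same measure at every parameter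
# (Track A, DAG node N13 = [B16]; cluster K1 — K1⁸ `StabilityBRunRowsAtRecordR13SepCoPH` = stmt-QuantumFields-26907 (K1⁷ 20542 aside), helper; seat `pub-ymgap-dag-n13-w3` g4, sequel of
# p616879 (F10) ∕ p618747 (F11); 2026-08-28; count-neutral)

HONEST FRAMING.  Count-neutral kernel BOOKKEEPING ([folklore] measure theory by name); nothing of Bałaban's is asserted or refuted.  p616879 typed the ITERATED one-step transport
`I_k = (T_{k−1}∘⋯∘T_0)(ρ₀)` of def-T's disintegration-kernel transports along the block averaging of record and showed `ρ_k ≤ I_k` everywhere (law (ii)) and `ρ_k =ᵃᵉ I_k` (laws (i)(ii)) —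
both through POINTWISE transports, hence under everywhere-boundedness rows on the iterates (`hIbdd`, a statement about the `Classical.choose` versions `avgDensity` ∕ `condKernel`) and
measurability rows on the history terms (`hmeas`); p618747 priced N13's node by ONE everywhere row `hIUV` on `I_k`.  Director-ym №210 (INBOX l.32415) ∕ plan g84 WORD-3 located that the
Cor-3 half of K1⁸'s (B) conjunct AS TYPED is decided by density VERSIONS and ordered: «Cor-3 suppliers at levels ≥ 1 land in VERSION-FREE currency (a.e. ∕ measure ∕ integrated)».  THIS FILE
is the measure currency for N13's upper half at the tree's parameters:
* §1 [folklore] `map_withDensity_eq_withDensity_of_isRT` — a renormalization transform in the cell's push-forward reading `Setup.IsRT` (`ρ, ρ′ ≥ 0` integrable, `avg` measurable) IS the identity of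
  measures `(ρ·dU).map avg = ρ′·dV` (test `IsRT` on indicators); `ae_le_iff_withDensity_le` — THE CURRENCY: `(∀ᵐ x, ρ x ≤ B) ↔ ∀ S, (ρ·μ)(S) ≤ ofReal B · μ(S)`.
* §2 (every Stage-13 parameter, NO proviso) ★★ `map_tower_rhoZero_eq_withDensity_iterTransport` — `(π_k)_*(ρ₀·dU_0) = I_k·dV_k` (`k ≤ K`) and `I_k` integrable, where `π_k = avg_{k−1}∘⋯∘avg_0` is the
  `k`-step averaging map of record (a `Nat.rec` term, like `I_k`; no definition introduced): BY NAME the finite-tower transport identification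
  `ShellMeasureHistoriesTransportIterate.map_withDensity_tower` (cell `pub-balaban`, NE7c crew) at `fieldMeasure`, `avOfRecord` (`avOfRecord_measurable`, `avOfRecord_haarAC` at `j < K`) and `ρ₀`
  (`integrable_rhoZeroOfRecord`, `rhoZeroOfRecord_pos`); mass `∫ I_k dV_k = ∫ ρ₀ dU_0`.
* §3 ★★★ `withDensity_densOfRecord₁₃_eq_map_tower_of_selLaws` — under K1's record provisos `Provisos₁₃SepCoPH` and the tree's selector laws (i) `hidem`, (ii) `hdead` AS TYPED at the levels
  `≤ k` (the node files' own hypotheses): `ρ_k·dV_k = (π_k)_*(ρ₀·dU_0)` — by induction through the record tower's OWN obligation `isRT_Trho` (def-T's `isRT_trhoOfRecord9` under row `tstep`),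
  its integrability (`isIntegrable_towerOfRecord₁₃SepCoPH`, `integrable_towerOfRecord₁₃SepCoPH_Trho`), `ρ ≥ 0` (p613238's `histTerm₁₃_nonneg`) and p583899's a.e. face `ρ_{j+1} =ᵃᵉ 𝐓ρ_j`
  (`densOfRecord₁₃_succ_ae_eq_tdens_of_selLaws_sepCoPH`); NO version, NO boundedness, NO measurability row.  COROLLARY ★★ `densOfRecord₁₃_ae_eq_iterTransport_of_selLaws'` — `ρ_k =ᵃᵉ I_k`
  WITHOUT p616879 §3's `hIbdd` ∕ `hmeas` (two non-negative integrable densities of one measure, `withDensity_eq_iff`).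
WHAT THIS SAYS (LOCATED, by name, count-neutral): at every parameter the node files cover, the represented tower's density of record is an honest Radon–Nikodym density of the
UNRENORMALISED `k`-fold averaged Gibbs measure `(π_k)_*(ρ₀ dU)` — the (2.18) expansion with a law-abiding selector and the 𝐑 of record RE-PRESENT that measure and contribute nothing else
(p615170: the 𝐑 of record never mixes histories under law (ii)); so the (UV₁₃) ∕ [III] Cor. 3 upper half there is a statement about THIS MEASURE — `(π_k)_*(ρ₀ dU) ≤ e^{E₊|T₁^{(k)}|}·Haar_k` —
which is (2.50)'s upper half for the unrenormalised averaged densities: Bałaban's ultraviolet stability proper, reached in print through the history-mixing 𝐑 of [IV] ((0.3) with nontrivial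
`Z′`; abstract, p.175); DISPLAYED in the sequel `…N13AERowOfAveragedGibbsMeasureBoundAtRecord13SepCoPH`, NOT proved.  (U1) NOT proved; Cor. 3 NOT proved; N13 NOT discharged; K0⁷ ∕ K1⁸ NOT closed;
no stub closed; counts unmoved (typed 28∕28 · discharged 5∕27 · Track A 5∕28).  ONE finite four-torus programme at fixed `ε = L^{−K}`, Bałaban AS PRINTED; R4 closes the conditional finite-𝕋⁴
rung `BalabanLadder.UV` only — the Yang–Mills mass gap (Clay) is NOT proved by any of this; nothing continuum ∕ ℝ⁴ ∕ OS.  No `sorry`, `def`, `instance`, `notation`.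

Sources: [Balaban1988Convergent] (2.18) p.257, Thm 1 p.262, Cor. 3 (2.50) p.264, (3.1) p.264, (3.25) p.270; [Balaban1989LargeFieldI] abstract, p.175, (0.2)–(0.4) p.176, (i)–(ii) p.177;
[Balaban1989LargeFieldII] Thm 1 + (0.1) pp.355–356; [Balaban1987RG1] (0.4) p.253 (the averaging); [Balaban1985Averaging] (10) p.19 (the renormalization transformation).
-/

noncomputable section

open MeasureTheory
open scoped BigOperators ENNReal Matrix.Norms.L2Operator

namespace Summit.QuantumFields.YangMills.BalabanUVNodes.N13DensityOfRecordIsAveragedGibbsMeasureAtRecord13SepCoPH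

open Literature.MathematicalPhysics.QuantumFieldTheory.Balaban1983to89
open T4Continuum Node00 B14.Eq218Concrete
open T4AveragingDisintegration (transportK kernelTransport)
open Summit.QuantumFields.BalabanUV.T4Continuum.ShellMeasureHistoriesTransportIterate (map_withDensity_tower)
open Summit.QuantumFields.YangMills.BalabanUVNodes.N13DensityBelowIteratedTransportOfDeadSelAtRecord13CoPH (iterTransport_measurable_nonneg)

/-! ## §1. [folklore] A renormalization transform in the push-forward reading (`Setup.IsRT`) IS an identity of measures -/

section Generic

variable {P : Params} {j : ℕ} {G : Type*} [GaugeGroup G] [MeasurableSpace G] [HaarData G]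

/-- **`IsRT` AS AN IDENTITY OF MEASURES.**  If `ρ′` is a renormalization transform of `ρ` along `avg` in the push-forward reading `Setup.IsRT` (tested against bounded measurable
functions), `avg` is measurable, and `ρ ≥ 0`, `ρ′ ≥ 0` a.e. are integrable, then the image of the tilted fine law IS the tilted coarse law:
`(dU.withDensity (ofReal ∘ ρ)).map avg = dV.withDensity (ofReal ∘ ρ′)` (test `IsRT` on indicators). [folklore] [cite: Balaban1985Averaging, (10) p.19 (bookkeeping)] -/
theorem map_withDensity_eq_withDensity_of_isRT {avg : GaugeField P j G → GaugeField P (j + 1) G} (havg : Measurable avg)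
    {ρ : Density P j G} {ρ' : Density P (j + 1) G} (hRT : IsRT avg ρ ρ')
    (hρ : Integrable ρ (fieldMeasure P j G)) (h0 : 0 ≤ᵐ[fieldMeasure P j G] ρ)
    (hρ' : Integrable ρ' (fieldMeasure P (j + 1) G)) (h0' : 0 ≤ᵐ[fieldMeasure P (j + 1) G] ρ') :
    ((fieldMeasure P j G).withDensity fun U => ENNReal.ofReal (ρ U)).map avg =
      (fieldMeasure P (j + 1) G).withDensity fun V => ENNReal.ofReal (ρ' V) := by
  ext S hS
  rw [Measure.map_apply havg hS, withDensity_apply _ (havg hS), withDensity_apply _ hS]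
  have hind : Measurable (S.indicator fun _ => (1 : ℝ)) := measurable_const.indicator hS
  have key := hRT (S.indicator fun _ => (1 : ℝ)) hind ⟨1, fun V => by by_cases hV : V ∈ S <;> simp [hV]⟩
  have e1 : (fun V => ρ' V * S.indicator (fun _ => (1 : ℝ)) V) = S.indicator ρ' := by
    funext V; by_cases hV : V ∈ S <;> simp [hV]
  have e2 : (fun U => ρ U * S.indicator (fun _ => (1 : ℝ)) (avg U)) = (avg ⁻¹' S).indicator ρ := by
    funext U; by_cases hU : U ∈ avg ⁻¹' S
    · have : avg U ∈ S := hU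
      simp [hU, this]
    · have : avg U ∉ S := hU
      simp [hU, this]
  rw [e1, e2, integral_indicator hS, integral_indicator (havg hS)] at key
  have hL : ENNReal.ofReal (∫ V in S, ρ' V ∂fieldMeasure P (j + 1) G) = ∫⁻ V in S, ENNReal.ofReal (ρ' V) ∂fieldMeasure P (j + 1) G :=
    ofReal_integral_eq_lintegral_ofReal hρ'.integrableOn (ae_restrict_of_ae h0')
  have hR : ENNReal.ofReal (∫ U in avg ⁻¹' S, ρ U ∂fieldMeasure P j G) = ∫⁻ U in avg ⁻¹' S, ENNReal.ofReal (ρ U) ∂fieldMeasure P j G :=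
    ofReal_integral_eq_lintegral_ofReal hρ.integrableOn (ae_restrict_of_ae h0)
  rw [← hR, ← hL, key]

/-- **THE MEASURE-INEQUALITY CURRENCY** for an a.e. upper bound on a density: for `ρ ≥ 0` a.e., `(∀ᵐ x, ρ x ≤ B) ↔ ∀ S measurable, (μ.withDensity (ofReal ∘ ρ)) S ≤ ofReal B · μ S`
(σ-finite `μ`, a.e.-measurable `ρ`). [folklore] [cite: Balaban1988Convergent, (2.50) p.264 (bookkeeping: the currency only)] -/
theorem ae_le_iff_withDensity_le {α : Type*} [MeasurableSpace α] {μ : Measure α} [SigmaFinite μ] {ρ : α → ℝ} (hρm : AEMeasurable ρ μ)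
    (h0 : 0 ≤ᵐ[μ] ρ) (B : ℝ) (hB : 0 ≤ B) :
    (∀ᵐ x ∂μ, ρ x ≤ B) ↔ ∀ S : Set α, MeasurableSet S → (μ.withDensity fun x => ENNReal.ofReal (ρ x)) S ≤ ENNReal.ofReal B * μ S := by
  constructor
  · intro hle S hS
    rw [withDensity_apply _ hS]
    calc ∫⁻ x in S, ENNReal.ofReal (ρ x) ∂μ ≤ ∫⁻ _ in S, ENNReal.ofReal B ∂μ :=
          lintegral_mono_ae (ae_restrict_of_ae (hle.mono fun x hx => ENNReal.ofReal_le_ofReal hx))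
      _ = ENNReal.ofReal B * μ S := by rw [setLIntegral_const]
  · intro hS
    have hle : (fun x => ENNReal.ofReal (ρ x)) ≤ᵐ[μ] fun _ => ENNReal.ofReal B := by
      refine ae_le_of_forall_setLIntegral_le_of_sigmaFinite₀ hρm.ennreal_ofReal fun S hSm _ => ?_
      rw [setLIntegral_const, ← withDensity_apply _ hSm]
      exact hS S hSm
    filter_upwards [hle, h0] with x hx h0x
    exact (ENNReal.ofReal_le_ofReal_iff hB).1 hx

end Generic

/-! ## §2. At def-T's record objects: the iterated transport of `ρ₀` IS a density of the `k`-fold block-averaged Wilson–Gibbs measure (by name: `map_withDensity_tower`) -/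

section Tower

variable (F : T4Family) (N : ℕ) [NeZero N]

/-- `ρ₀ = e^{−E}·exp(−A/g₀²)` is integrable for product Haar measure (a probability measure; `Missing.integrable_boltzmann`). [cite: Balaban1988Convergent, Thm 1 p.262 (bookkeeping)] -/
theorem integrable_rhoZeroOfRecord (K : ℕ) (g₀ E : ℝ) : Integrable (rhoZeroOfRecord F N K g₀ E) (fieldMeasure (F.P K) 0 (SU N)) :=
  (Missing.integrable_boltzmann RegularGaugeGroup.measurable_reTr (F.P K) (sq_nonneg _)).const_mul _

/-- The `k`-step averaging map of record `π_k = avg_{k−1} ∘ ⋯ ∘ avg_0` (a `Nat.rec` term; no definition introduced) is measurable. [cite: Balaban1987RG1, (0.4) p.253 (bookkeeping)] -/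
theorem measurable_iterAvgOfRecord (K k : ℕ) :
    Measurable (Nat.rec (motive := fun j => GaugeField (F.P K) 0 (SU N) → GaugeField (F.P K) j (SU N)) id (fun j π => (avOfRecord F N K j).avg ∘ π) k) := by
  induction k with
  | zero => exact measurable_id
  | succ k ih => exact (avOfRecord_measurable F N K k).comp ih

variable (θ : Stage13HParams F N) (P : B12.RunParams)

/-- **★★ THE ITERATED TRANSPORT OF `ρ₀` IS A DENSITY OF THE `k`-FOLD BLOCK-AVERAGED WILSON–GIBBS MEASURE** (every level `k ≤ K`, every Stage-13 parameter, NO proviso): with def-T's one-step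
transports `T_j = transportOfRecord F N K j` (the disintegration-kernel transport along Bałaban's block averaging of record `avOfRecord`) iterated from `ρ₀` — the `Nat.rec` term
`I_0 = ρ₀`, `I_{j+1} = T_j(I_j)` of p616879 — and the `k`-step averaging map of record `π_k = avg_{k−1} ∘ ⋯ ∘ avg_0` (the `Nat.rec` term `π_0 = id`, `π_{j+1} = avg_j ∘ π_j`):
`(ρ₀·dU_0).map π_k = I_k·dV_k`, i.e. `(π_k)_*(ρ₀ dU) = dV_k.withDensity (ofReal ∘ I_k)`; and `I_k` is `dV_k`-integrable.  BY NAME: the finite-tower transport identification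
`ShellMeasureHistoriesTransportIterate.map_withDensity_tower` (cell `pub-balaban`) at the references `fieldMeasure`, the averagings of record (`avOfRecord_measurable`, `avOfRecord_haarAC` at every
`j < K`) and `ρ₀` (integrable, positive).  So `I_k` is what print calls the `k`-th effective density `∫dU Π_j δ(avg_j ⋯) ρ₀` read as a Radon–Nikodym density — a VERSION; the MEASURE on the left
is version-free. [cite: Balaban1988Convergent, Thm 1 p.262, (3.1) p.264; Balaban1987RG1, (0.4) p.253; Balaban1985Averaging, (10) p.19 (bookkeeping)] -/
theorem map_tower_rhoZero_eq_withDensity_iterTransport (k : ℕ) (hk : k ≤ P.K) :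
    Integrable (Nat.rec (motive := fun j => GaugeField (F.P P.K) j (SU N) → ℝ)
        (rhoZeroOfRecord F N P.K (gOfRecord₁₃ F N θ.toStage13Params P 0) (EOfRecord₁₃ F N θ.toStage13Params P))
        (fun j I => transportOfRecord F N P.K j I) k) (fieldMeasure (F.P P.K) k (SU N)) ∧
    ((fieldMeasure (F.P P.K) 0 (SU N)).withDensity fun U =>
        ENNReal.ofReal (rhoZeroOfRecord F N P.K (gOfRecord₁₃ F N θ.toStage13Params P 0) (EOfRecord₁₃ F N θ.toStage13Params P) U)).map
      (Nat.rec (motive := fun j => GaugeField (F.P P.K) 0 (SU N) → GaugeField (F.P P.K) j (SU N)) id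
        (fun j π => (avOfRecord F N P.K j).avg ∘ π) k) =
    (fieldMeasure (F.P P.K) k (SU N)).withDensity fun V => ENNReal.ofReal
      (Nat.rec (motive := fun j => GaugeField (F.P P.K) j (SU N) → ℝ)
        (rhoZeroOfRecord F N P.K (gOfRecord₁₃ F N θ.toStage13Params P 0) (EOfRecord₁₃ F N θ.toStage13Params P))
        (fun j I => transportOfRecord F N P.K j I) k V) := by
  have h := map_withDensity_tower (β := fun j => GaugeField (F.P P.K) j (SU N)) (fun j => fieldMeasure (F.P P.K) j (SU N))
    (fun j => (avOfRecord F N P.K j).avg) (M := P.K) (fun j _ => avOfRecord_measurable F N P.K j) (fun j hj => avOfRecord_haarAC F N P.K j hj)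
    (fun j => Nat.rec (motive := fun j => GaugeField (F.P P.K) 0 (SU N) → GaugeField (F.P P.K) j (SU N)) id (fun j π => (avOfRecord F N P.K j).avg ∘ π) j)
    rfl (fun _ _ => rfl)
    (fun j => Nat.rec (motive := fun j => GaugeField (F.P P.K) j (SU N) → ℝ)
      (rhoZeroOfRecord F N P.K (gOfRecord₁₃ F N θ.toStage13Params P 0) (EOfRecord₁₃ F N θ.toStage13Params P)) (fun j I => transportOfRecord F N P.K j I) j)
    (fun _ _ => rfl) (integrable_rhoZeroOfRecord F N P.K _ _) (fun U => (rhoZeroOfRecord_pos F N P.K _ _ U).le) k hk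
  exact ⟨h.2.1, h.2.2.2⟩

/-- COROLLARY: the `k`-fold averaged Wilson–Gibbs measure has the same total mass as `ρ₀·dU_0` — `∫ I_k dV_k = ∫ ρ₀ dU_0` (`k ≤ K`). [cite: Balaban1987RG1, (0.4) p.253 (bookkeeping)] -/
theorem integral_iterTransport_eq_integral_rhoZero (k : ℕ) (hk : k ≤ P.K) :
    ∫ V, Nat.rec (motive := fun j => GaugeField (F.P P.K) j (SU N) → ℝ)
        (rhoZeroOfRecord F N P.K (gOfRecord₁₃ F N θ.toStage13Params P 0) (EOfRecord₁₃ F N θ.toStage13Params P))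
        (fun j I => transportOfRecord F N P.K j I) k V ∂fieldMeasure (F.P P.K) k (SU N) =
      ∫ U, rhoZeroOfRecord F N P.K (gOfRecord₁₃ F N θ.toStage13Params P 0) (EOfRecord₁₃ F N θ.toStage13Params P) U ∂fieldMeasure (F.P P.K) 0 (SU N) := by
  obtain ⟨hI, hmap⟩ := map_tower_rhoZero_eq_withDensity_iterTransport F N θ P k hk
  have h0 := (iterTransport_measurable_nonneg F N θ P k).2
  have hπ := measurable_iterAvgOfRecord F N P.K k
  have e1 : ENNReal.ofReal (∫ V, Nat.rec (motive := fun j => GaugeField (F.P P.K) j (SU N) → ℝ)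
        (rhoZeroOfRecord F N P.K (gOfRecord₁₃ F N θ.toStage13Params P 0) (EOfRecord₁₃ F N θ.toStage13Params P))
        (fun j I => transportOfRecord F N P.K j I) k V ∂fieldMeasure (F.P P.K) k (SU N)) =
      ((fieldMeasure (F.P P.K) k (SU N)).withDensity fun V => ENNReal.ofReal
        (Nat.rec (motive := fun j => GaugeField (F.P P.K) j (SU N) → ℝ)
          (rhoZeroOfRecord F N P.K (gOfRecord₁₃ F N θ.toStage13Params P 0) (EOfRecord₁₃ F N θ.toStage13Params P))
          (fun j I => transportOfRecord F N P.K j I) k V)) Set.univ := by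
    rw [withDensity_apply _ MeasurableSet.univ, Measure.restrict_univ, ofReal_integral_eq_lintegral_ofReal hI (ae_of_all _ h0)]
  have e2 : ENNReal.ofReal (∫ U, rhoZeroOfRecord F N P.K (gOfRecord₁₃ F N θ.toStage13Params P 0) (EOfRecord₁₃ F N θ.toStage13Params P) U ∂fieldMeasure (F.P P.K) 0 (SU N)) =
      ((fieldMeasure (F.P P.K) 0 (SU N)).withDensity fun U =>
        ENNReal.ofReal (rhoZeroOfRecord F N P.K (gOfRecord₁₃ F N θ.toStage13Params P 0) (EOfRecord₁₃ F N θ.toStage13Params P) U)) Set.univ := by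
    rw [withDensity_apply _ MeasurableSet.univ, Measure.restrict_univ,
      ofReal_integral_eq_lintegral_ofReal (integrable_rhoZeroOfRecord F N P.K _ _) (ae_of_all _ fun U => (rhoZeroOfRecord_pos F N P.K _ _ U).le)]
  have e3 : ((fieldMeasure (F.P P.K) k (SU N)).withDensity fun V => ENNReal.ofReal
        (Nat.rec (motive := fun j => GaugeField (F.P P.K) j (SU N) → ℝ)
          (rhoZeroOfRecord F N P.K (gOfRecord₁₃ F N θ.toStage13Params P 0) (EOfRecord₁₃ F N θ.toStage13Params P))
          (fun j I => transportOfRecord F N P.K j I) k V)) Set.univ =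
      ((fieldMeasure (F.P P.K) 0 (SU N)).withDensity fun U =>
        ENNReal.ofReal (rhoZeroOfRecord F N P.K (gOfRecord₁₃ F N θ.toStage13Params P 0) (EOfRecord₁₃ F N θ.toStage13Params P) U)) Set.univ := by
    rw [← hmap, Measure.map_apply hπ MeasurableSet.univ, Set.preimage_univ]
  have key : ENNReal.ofReal (∫ V, Nat.rec (motive := fun j => GaugeField (F.P P.K) j (SU N) → ℝ)
        (rhoZeroOfRecord F N P.K (gOfRecord₁₃ F N θ.toStage13Params P 0) (EOfRecord₁₃ F N θ.toStage13Params P))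
        (fun j I => transportOfRecord F N P.K j I) k V ∂fieldMeasure (F.P P.K) k (SU N)) =
      ENNReal.ofReal (∫ U, rhoZeroOfRecord F N P.K (gOfRecord₁₃ F N θ.toStage13Params P 0) (EOfRecord₁₃ F N θ.toStage13Params P) U ∂fieldMeasure (F.P P.K) 0 (SU N)) := by
    rw [e1, e2, e3]
  exact (ENNReal.ofReal_eq_ofReal_iff (integral_nonneg h0) (integral_nonneg fun U => (rhoZeroOfRecord_pos F N P.K _ _ U).le)).1 key

end Tower

/-! ## §3. ★★★ Under the tree's selector laws (i)(ii): the DENSITY OF RECORD is a density of the `k`-fold block-averaged Wilson–Gibbs measure — no version, no boundedness row -/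

section Record

variable (F : T4Family) (N : ℕ) [NeZero N] (θ : Stage13HParams F N) (P : B12.RunParams)

open Summit.QuantumFields.YangMills.BalabanUVNodes.N13TStepDensityIsTransportAtRecord13CoPH (histTerm₁₃_nonneg)

/-- `ρ_k ≥ 0` at every field (the history terms are `≥ 0` under the core provisos' ζ-rows; p613238's `histTerm₁₃_nonneg` summed). [cite: Balaban1988Convergent, (2.18) p.257 (bookkeeping)] -/
theorem densOfRecord₁₃_nonneg (h : θ.Provisos₁₃CoPH F N) (k : ℕ) (V : GaugeField (F.P P.K) k (SU N)) :
    0 ≤ densOfRecord₁₃ F N θ.toStage13Params P k V :=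
  Finset.sum_nonneg fun s _ => histTerm₁₃_nonneg F N θ P h k s V

open Classical in
/-- **★★★ THE DENSITY OF RECORD TIMES HAAR IS THE `k`-FOLD BLOCK-AVERAGED WILSON–GIBBS MEASURE** under K1's record provisos `Provisos₁₃SepCoPH` and the tree's selector laws (i) `hidem`,
(ii) `hdead` AS TYPED at the levels `≤ k` (`k ≤ K`; the node files' own hypotheses, p583899 ∕ p604459 ∕ p610463): `ρ_k·dV_k = (avg_{k−1} ∘ ⋯ ∘ avg_0)_*(ρ₀·dU_0)`, i.e.
`dV_k.withDensity (ofReal ∘ ρ_k) = (ρ₀·dU_0).map π_k` — an identity of MEASURES, hence VERSION-FREE: it does not read the `Classical.choose` versions (`avgDensity`, `condKernel`) through which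
`ρ_k` is defined, and it asks NO everywhere-boundedness ∕ measurability row (contrast p616879 §3, which reaches `ρ_k =ᵃᵉ I_k` through pointwise transports and needs both).  PROOF, by
induction on `k`: `ρ_{j+1}·dV =ᵃᵉ 𝐓ρ_j·dV` (p583899's a.e. face `densOfRecord₁₃_succ_ae_eq_tdens_of_selLaws_sepCoPH`, laws (i)(ii)) `= (ρ_j·dV).map avg_j` (§1 at the record tower's
OWN obligation `isRT_Trho` — def-T's `isRT_trhoOfRecord9` under row `tstep` — with the tower's integrability `isIntegrable_towerOfRecord₁₃SepCoPH` ∕ `integrable_towerOfRecord₁₃SepCoPH_Trho` and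
`ρ ≥ 0`) `= ((ρ₀·dU).map π_j).map avg_j = (ρ₀·dU).map π_{j+1}`.  READING (LOCATED, count-neutral): at every parameter the node files cover, the represented tower's density IS an honest
density of the UNRENORMALISED `k`-fold averaged Gibbs measure — the (2.18) expansion with a law-abiding selector and the 𝐑 of record re-present that measure and contribute nothing else;
so the (UV₁₃) ∕ [III] Cor. 3 upper half there is a statement about THIS MEASURE (§4).  Nothing of Bałaban's asserted. [cite: Balaban1988Convergent, (2.18) p.257, Thm 1 p.262, (3.1) p.264, (3.25) p.270; Balaban1989LargeFieldI, (0.2)–(0.4) p.176, (i)–(ii) p.177; Balaban1987RG1, (0.4) p.253] -/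
theorem withDensity_densOfRecord₁₃_eq_map_tower_of_selLaws (h : θ.Provisos₁₃SepCoPH F N) (k : ℕ) (hk : k ≤ P.K)
    (hidem : ∀ j, j < k → ∀ a : SeqOfRecord F θ.ν θ.τ9.M (gOfRecord₁₃ F N θ.toStage13Params P) P.K (j + 1),
      θ.ppSel P (gOfRecord₁₃ F N θ.toStage13Params P) (j + 1) (θ.ppSel P (gOfRecord₁₃ F N θ.toStage13Params P) (j + 1) a)
        = θ.ppSel P (gOfRecord₁₃ F N θ.toStage13Params P) (j + 1) a)
    (hdead : ∀ j, j < k → ∀ a : SeqOfRecord F θ.ν θ.τ9.M (gOfRecord₁₃ F N θ.toStage13Params P) P.K (j + 1), θ.ppSel P (gOfRecord₁₃ F N θ.toStage13Params P) (j + 1) a ≠ a →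
      ∀ V, B15.BasicStep.fibreIntegral (fibOfSeq F θ.ν θ.τ9 P (gOfRecord₁₃ F N θ.toStage13Params P) (j + 1) a)
        (rterm (sliceOfRecord F N θ.ν θ.τ9.M P (gOfRecord₁₃ F N θ.toStage13Params P) (j + 1)
          (slotsTOfRecord F N θ.ν θ.τ9 (EOfRecord₁₃ F N θ.toStage13Params) (wOfRecord₉ F N θ.toStage9Params) θ.ppSel P (gOfRecord₁₃ F N θ.toStage13Params P) (j + 1))) a) V = 0) :
    ((fieldMeasure (F.P P.K) k (SU N)).withDensity fun V => ENNReal.ofReal (densOfRecord₁₃ F N θ.toStage13Params P k V)) =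
      ((fieldMeasure (F.P P.K) 0 (SU N)).withDensity fun U =>
          ENNReal.ofReal (rhoZeroOfRecord F N P.K (gOfRecord₁₃ F N θ.toStage13Params P 0) (EOfRecord₁₃ F N θ.toStage13Params P) U)).map
        (Nat.rec (motive := fun j => GaugeField (F.P P.K) 0 (SU N) → GaugeField (F.P P.K) j (SU N)) id
          (fun j π => (avOfRecord F N P.K j).avg ∘ π) k) := by
  induction k with
  | zero =>
    show _ = Measure.map id _
    rw [Measure.map_id, densOfRecord₁₃_zero, show gOfRecord₁₃ F N θ.toStage13Params P 0 = P.g0 from FlowStepRuns.genSeq_zero _ _]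
  | succ k ih =>
    have hkK : k < P.K := Nat.lt_of_succ_le hk
    have ih' := ih hkK.le (fun j hj => hidem j (Nat.lt_succ_of_lt hj)) (fun j hj => hdead j (Nat.lt_succ_of_lt hj))
    -- the record tower's own push-forward obligation at step `k`, its integrability rows, positivity
    have hRT : IsRT (avOfRecord F N P.K k).avg (densOfRecord₁₃ F N θ.toStage13Params P k) (tdensOfRecord₁₃ F N θ.toStage13Params P k) :=
      (towerOfRecord₁₃SepCoPH F N θ h).isRT_Trho P k hkK
    have hρi : Integrable (densOfRecord₁₃ F N θ.toStage13Params P k) (fieldMeasure (F.P P.K) k (SU N)) :=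
      isIntegrable_towerOfRecord₁₃SepCoPH F N θ h P k hkK.le
    have hTi : Integrable (tdensOfRecord₁₃ F N θ.toStage13Params P k) (fieldMeasure (F.P P.K) (k + 1) (SU N)) :=
      integrable_towerOfRecord₁₃SepCoPH_Trho F N θ h P k hkK
    have hae := B16RLeafRecord13SepCoPHSelLaws.densOfRecord₁₃_succ_ae_eq_tdens_of_selLaws_sepCoPH F N θ P h k hkK
      (hidem k (Nat.lt_succ_self k)) (hdead k (Nat.lt_succ_self k))
    have hT0 : 0 ≤ᵐ[fieldMeasure (F.P P.K) (k + 1) (SU N)] tdensOfRecord₁₃ F N θ.toStage13Params P k := by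
      filter_upwards [hae] with V hV
      rw [← hV]
      exact densOfRecord₁₃_nonneg F N θ P h.toCore (k + 1) V
    have h1 : ((fieldMeasure (F.P P.K) (k + 1) (SU N)).withDensity fun V => ENNReal.ofReal (densOfRecord₁₃ F N θ.toStage13Params P (k + 1) V)) =
        (fieldMeasure (F.P P.K) (k + 1) (SU N)).withDensity fun V => ENNReal.ofReal (tdensOfRecord₁₃ F N θ.toStage13Params P k V) :=
      withDensity_congr_ae (hae.mono fun V hV => by show ENNReal.ofReal _ = ENNReal.ofReal _; rw [hV])
    rw [h1, ← map_withDensity_eq_withDensity_of_isRT (avOfRecord_measurable F N P.K k) hRT hρi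
      (ae_of_all _ fun U => densOfRecord₁₃_nonneg F N θ P h.toCore k U) hTi hT0, ih',
      Measure.map_map (avOfRecord_measurable F N P.K k) (measurable_iterAvgOfRecord F N P.K k)]

open Classical in
/-- **COROLLARY — `ρ_k =ᵃᵉ I_k` WITH NO BOUNDEDNESS ∕ MEASURABILITY ROW** (improves p616879 §3 `densOfRecord₁₃_ae_eq_iterTransport_of_selLaws`, which displayed `hIbdd` and `hmeas`): the
density of record and the iterated transport of `ρ₀` are two integrable non-negative densities of the SAME measure (§2 + the theorem above), hence equal `dV_k`-a.e. (`withDensity_eq_iff`).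
[cite: Balaban1988Convergent, (2.18) p.257, Thm 1 p.262, (3.1) p.264; Balaban1989LargeFieldI, (0.3) p.176, (i)–(ii) p.177] -/
theorem densOfRecord₁₃_ae_eq_iterTransport_of_selLaws' (h : θ.Provisos₁₃SepCoPH F N) (k : ℕ) (hk : k ≤ P.K)
    (hidem : ∀ j, j < k → ∀ a : SeqOfRecord F θ.ν θ.τ9.M (gOfRecord₁₃ F N θ.toStage13Params P) P.K (j + 1),
      θ.ppSel P (gOfRecord₁₃ F N θ.toStage13Params P) (j + 1) (θ.ppSel P (gOfRecord₁₃ F N θ.toStage13Params P) (j + 1) a)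
        = θ.ppSel P (gOfRecord₁₃ F N θ.toStage13Params P) (j + 1) a)
    (hdead : ∀ j, j < k → ∀ a : SeqOfRecord F θ.ν θ.τ9.M (gOfRecord₁₃ F N θ.toStage13Params P) P.K (j + 1), θ.ppSel P (gOfRecord₁₃ F N θ.toStage13Params P) (j + 1) a ≠ a →
      ∀ V, B15.BasicStep.fibreIntegral (fibOfSeq F θ.ν θ.τ9 P (gOfRecord₁₃ F N θ.toStage13Params P) (j + 1) a)
        (rterm (sliceOfRecord F N θ.ν θ.τ9.M P (gOfRecord₁₃ F N θ.toStage13Params P) (j + 1)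
          (slotsTOfRecord F N θ.ν θ.τ9 (EOfRecord₁₃ F N θ.toStage13Params) (wOfRecord₉ F N θ.toStage9Params) θ.ppSel P (gOfRecord₁₃ F N θ.toStage13Params P) (j + 1))) a) V = 0) :
    densOfRecord₁₃ F N θ.toStage13Params P k =ᵐ[fieldMeasure (F.P P.K) k (SU N)]
      Nat.rec (motive := fun j => GaugeField (F.P P.K) j (SU N) → ℝ)
        (rhoZeroOfRecord F N P.K (gOfRecord₁₃ F N θ.toStage13Params P 0) (EOfRecord₁₃ F N θ.toStage13Params P))
        (fun j I => transportOfRecord F N P.K j I) k := by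
  obtain ⟨hI, hmap⟩ := map_tower_rhoZero_eq_withDensity_iterTransport F N θ P k hk
  have hρi : Integrable (densOfRecord₁₃ F N θ.toStage13Params P k) (fieldMeasure (F.P P.K) k (SU N)) :=
    isIntegrable_towerOfRecord₁₃SepCoPH F N θ h P k hk
  have heq := (withDensity_densOfRecord₁₃_eq_map_tower_of_selLaws F N θ P h k hk hidem hdead).trans hmap
  have hfin : ∫⁻ V, ENNReal.ofReal (densOfRecord₁₃ F N θ.toStage13Params P k V) ∂fieldMeasure (F.P P.K) k (SU N) ≠ ∞ := by
    rw [← setLIntegral_univ, ← withDensity_apply _ MeasurableSet.univ, heq, withDensity_apply _ MeasurableSet.univ, setLIntegral_univ,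
      ← ofReal_integral_eq_lintegral_ofReal hI (ae_of_all _ (iterTransport_measurable_nonneg F N θ P k).2)]
    exact ENNReal.ofReal_ne_top
  have hae := (withDensity_eq_iff hρi.1.aemeasurable.ennreal_ofReal hI.1.aemeasurable.ennreal_ofReal hfin).1 heq
  filter_upwards [hae] with V hV
  have h0 := densOfRecord₁₃_nonneg F N θ P h.toCore k V
  have h0' := (iterTransport_measurable_nonneg F N θ P k).2 V
  rwa [ENNReal.ofReal_eq_ofReal_iff h0 h0'] at hV

end Record

end Summit.QuantumFields.YangMills.BalabanUVNodes.N13DensityOfRecordIsAveragedGibbsMeasureAtRecord13SepCoPH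

end
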